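import Summits.Ventures.CertifiedManyBodySolver.Downfold.EmeryOrbitalWeightFaceLever
import HarnessLib

/-!
# THE ANTINODAL FERMI POINT MOVES MONOTONICALLY: on the face window the zone-face ordinate `yFace(ε) = (cA − 4fsD)/(4fsD + 16fsN)` of the σ three-band `ε`-contour is NON-DECREASING in the
# energy — electron filling drives the antinodal Fermi point of a hole-like surface toward the zone corner, hole doping toward `(π, 0)`

Venture CertifiedManyBodySolver, cell `pub/hubbard-downfold` (stage S1; INFLATION-RULES-3to1-B §B.73/§B.74/§B.75 — the face point that carries the antinodal weight and scale levers),
seat hubbard-downfold-mod-4 (technique B, g30); namespace `Summit.Ventures.CertifiedManyBodySolver.Downfold.Emery`. Sequel of `EmeryOrbitalWeightCheck` (`yFace`), `EmeryOrbitalWeightFace`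
(`faceG`, `faceG_mono`, `fsN_nonneg`) and `EmeryOrbitalWeightFaceLever` (`faceHi_eq`, `faceHi_anti`). Everything PROVED (0 sorry). WHAT THIS IS NOT: a statement about any material; `U = 0`
one-body kinematics of the σ model as printed.

* §1 `yFaceCert` — an 83-term Handelman-form polynomial in `(Δ, ε₁, d, t_pp′, h = t_pp − t_pp′, m = t_pd² − t_pp′ε₂)` and the window atoms `G₁ = faceG(ε₁)`, `G₂ = (8fsD + 16fsN − cA)(ε₂)`
  with positive integer weights (found by linear programming, kit j339613 of this seat; checked here by `positivity` and `ring`): `2·((cA − 4fsD)(ε₂)·F(ε₁) − (cA − 4fsD)(ε₁)·F(ε₂)) =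
  (ε₂ − ε₁)·yFaceCert`, `F = 4fsD + 16fsN` (`yFace_cross_eq`).
* §2 **`yFace_mono`**: `Δ ≥ 0`, `0 ≤ t_pp′ ≤ t_pp`, `0 < ε₁ ≤ ε₂`, `t_pp′ε₂ < t_pd²`, `faceG(ε₁) ≥ 0`, `cA(ε₂) ≤ (8fsD + 16fsN)(ε₂)` ⇒ `yFace(ε₁) ≤ yFace(ε₂)`; equivalently the face value of the
  t′ harmonic `s = 1 − yFace` (`EmeryFermiScaleHarmonic.tpHarm_face`) is non-increasing (`one_sub_yFace_anti`).

Sources: three-band model [HybertsenSchluterChristensen1989, Eq. (1)]; bilinear contour [AndersenEtAl1995, §6]; Handelman certificates [folklore] (Handelman, Pacific J. Math. 132 (1988)).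
-/

noncomputable section

namespace Summit.Ventures.CertifiedManyBodySolver.Downfold.Emery

open Real Set

/-! ## §1 The certificate -/

/-- Part 1 of the certificate polynomial `yFaceCert` (28 positively weighted products, integer weights). [folklore] -/
def yFaceCertP1 (Δ ε₁ d c h m _G₁ _G₂ : ℝ) : ℝ :=
  64 * d * h ^ 2 * m + 128 * d * c * h * m + 64 * d ^ 2 * h * m + 64 * d ^ 3 * c * h + 32 * d ^ 3 * c ^ 2 + 4 * d ^ 4 * c + 64 * ε₁ * h ^ 2 * m +
  128 * ε₁ * d * h * m + 96 * ε₁ * d * c * m + 256 * ε₁ * d * c ^ 3 + 192 * ε₁ * d ^ 2 * c * h + 320 * ε₁ * d ^ 2 * c ^ 2 + 36 * ε₁ * d ^ 3 * c +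
  2 * ε₁ * d ^ 4 + 32 * ε₁ ^ 2 * h * m + 192 * ε₁ ^ 2 * d * c * h + 384 * ε₁ ^ 2 * d * c ^ 2 + 100 * ε₁ ^ 2 * d ^ 2 * c + 9 * ε₁ ^ 2 * d ^ 3 +
  4 * ε₁ ^ 3 * m + 64 * ε₁ ^ 3 * c * h + 64 * ε₁ ^ 3 * c ^ 2 + 80 * ε₁ ^ 3 * d * c + 13 * ε₁ ^ 3 * d ^ 2 + 16 * ε₁ ^ 4 * c + 7 * ε₁ ^ 4 * d +
  128 * Δ * h ^ 2 * m + 256 * Δ * c * h * m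

/-- `yFaceCertP1 ≥ 0` for non-negative arguments. [folklore] -/
theorem yFaceCertP1_nonneg {Δ ε₁ d c h m G₁ G₂ : ℝ} (hΔ : 0 ≤ Δ) (h1 : 0 ≤ ε₁) (hd : 0 ≤ d) (hc : 0 ≤ c) (hh : 0 ≤ h) (hm : 0 ≤ m) :
    0 ≤ yFaceCertP1 Δ ε₁ d c h m G₁ G₂ := by
  unfold yFaceCertP1
  positivity

/-- Part 2 of the certificate polynomial `yFaceCert` (28 positively weighted products, integer weights). [folklore] -/
def yFaceCertP2 (Δ ε₁ d c h m _G₁ _G₂ : ℝ) : ℝ :=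
  128 * Δ * d * h * m + 96 * Δ * d * c * m + 128 * Δ * d ^ 2 * c * h + 192 * Δ * d ^ 2 * c ^ 2 + 16 * Δ * d ^ 3 * c + 96 * Δ * ε₁ * h * m +
  64 * Δ * ε₁ * c * m + 8 * Δ * ε₁ * d * m + 256 * Δ * ε₁ * d * c * h + 512 * Δ * ε₁ * d * c ^ 2 + 128 * Δ * ε₁ * d ^ 2 * c + 7 * Δ * ε₁ * d ^ 3 +
  16 * Δ * ε₁ ^ 2 * m + 128 * Δ * ε₁ ^ 2 * c * h + 192 * Δ * ε₁ ^ 2 * c ^ 2 + 176 * Δ * ε₁ ^ 2 * d * c + 23 * Δ * ε₁ ^ 2 * d ^ 2 + 48 * Δ * ε₁ ^ 3 * c +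
  19 * Δ * ε₁ ^ 3 * d + 64 * Δ ^ 2 * h * m + 64 * Δ ^ 2 * c * m + 12 * Δ ^ 2 * d * m + 64 * Δ ^ 2 * d * c * h + 128 * Δ ^ 2 * d * c ^ 2 +
  32 * Δ ^ 2 * d ^ 2 * c + 20 * Δ ^ 2 * ε₁ * m + 64 * Δ ^ 2 * ε₁ * c * h + 128 * Δ ^ 2 * ε₁ * c ^ 2

/-- `yFaceCertP2 ≥ 0` for non-negative arguments. [folklore] -/
theorem yFaceCertP2_nonneg {Δ ε₁ d c h m G₁ G₂ : ℝ} (hΔ : 0 ≤ Δ) (h1 : 0 ≤ ε₁) (hd : 0 ≤ d) (hc : 0 ≤ c) (hh : 0 ≤ h) (hm : 0 ≤ m) :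
    0 ≤ yFaceCertP2 Δ ε₁ d c h m G₁ G₂ := by
  unfold yFaceCertP2
  positivity

/-- Part 3 of the certificate polynomial `yFaceCert` (27 positively weighted products, integer weights). [folklore] -/
def yFaceCertP3 (Δ ε₁ d c h m G₁ G₂ : ℝ) : ℝ :=
  112 * Δ ^ 2 * ε₁ * d * c + 10 * Δ ^ 2 * ε₁ * d ^ 2 + 48 * Δ ^ 2 * ε₁ ^ 2 * c + 16 * Δ ^ 2 * ε₁ ^ 2 * d + 8 * Δ ^ 3 * m + 16 * Δ ^ 3 * d * c +
  16 * Δ ^ 3 * ε₁ * c + 4 * Δ ^ 3 * ε₁ * d + 32 * h * m * G₁ + 64 * c * m * G₁ + 16 * d * m * G₁ + 1 * d ^ 3 * G₁ + 8 * ε₁ * m * G₁ +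
  64 * ε₁ * c ^ 2 * G₁ + 5 * ε₁ * d ^ 2 * G₁ + 1 * ε₁ ^ 2 * d * G₁ + 8 * Δ * m * G₁ + 4 * d * c * G₂ + 8 * ε₁ * c * G₂ + 2 * ε₁ * d * G₂ +
  3 * ε₁ ^ 2 * G₂ + 8 * Δ * c * G₂ + 3 * Δ * ε₁ * G₂ + 6 * d * G₁ ^ 2 + 4 * ε₁ * G₁ ^ 2 + 4 * Δ * G₁ ^ 2 + 1 * G₁ * G₂

/-- `yFaceCertP3 ≥ 0` for non-negative arguments. [folklore] -/
theorem yFaceCertP3_nonneg {Δ ε₁ d c h m G₁ G₂ : ℝ} (hΔ : 0 ≤ Δ) (h1 : 0 ≤ ε₁) (hd : 0 ≤ d) (hc : 0 ≤ c) (hh : 0 ≤ h) (hm : 0 ≤ m) (hG₁ : 0 ≤ G₁) (hG₂ : 0 ≤ G₂) :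
    0 ≤ yFaceCertP3 Δ ε₁ d c h m G₁ G₂ := by
  unfold yFaceCertP3
  positivity

/-- **The certificate polynomial `yFaceCert`** (83 products, integer weights after scaling by 2; atoms `G₁ = faceG(ε₁)`, `G₂ = (8fsD + 16fsN − cA)(ε₂)`; 3 parts). [folklore] -/
def yFaceCert (Δ ε₁ d c h m G₁ G₂ : ℝ) : ℝ :=
  yFaceCertP1 Δ ε₁ d c h m G₁ G₂ + yFaceCertP2 Δ ε₁ d c h m G₁ G₂ + yFaceCertP3 Δ ε₁ d c h m G₁ G₂

/-- `yFaceCert ≥ 0` for non-negative arguments. [folklore] -/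
theorem yFaceCert_nonneg {Δ ε₁ d c h m G₁ G₂ : ℝ} (hΔ : 0 ≤ Δ) (h1 : 0 ≤ ε₁) (hd : 0 ≤ d) (hc : 0 ≤ c) (hh : 0 ≤ h) (hm : 0 ≤ m) (hG₁ : 0 ≤ G₁) (hG₂ : 0 ≤ G₂) :
    0 ≤ yFaceCert Δ ε₁ d c h m G₁ G₂ := by
  have p1 : 0 ≤ yFaceCertP1 Δ ε₁ d c h m G₁ G₂ := yFaceCertP1_nonneg (hΔ := hΔ) (h1 := h1) (hd := hd) (hc := hc) (hh := hh) (hm := hm)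
  have p2 : 0 ≤ yFaceCertP2 Δ ε₁ d c h m G₁ G₂ := yFaceCertP2_nonneg (hΔ := hΔ) (h1 := h1) (hd := hd) (hc := hc) (hh := hh) (hm := hm)
  have p3 : 0 ≤ yFaceCertP3 Δ ε₁ d c h m G₁ G₂ := yFaceCertP3_nonneg (hΔ := hΔ) (h1 := h1) (hd := hd) (hc := hc) (hh := hh) (hm := hm) (hG₁ := hG₁) (hG₂ := hG₂)
  unfold yFaceCert
  linarith

/-- **THE CERTIFICATE IDENTITY** (`t_pp = c + h`, `ε₂ = ε₁ + d`, `m = t_pd² − c·ε₂`; scaled by 2): `2·((cA − 4fsD)(ε₂)·F(ε₁) − (cA − 4fsD)(ε₁)·F(ε₂)) = d·yFaceCert`. [folklore] -/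
theorem yFace_cross_eq (Δ tpd c h ε₁ d : ℝ) :
    (2 : ℝ) * ((cA Δ (ε₁ + d) - 4 * fsD Δ tpd c (ε₁ + d)) * (4 * fsD Δ tpd c ε₁ + 16 * fsN tpd (c + h) c ε₁)
      - (cA Δ ε₁ - 4 * fsD Δ tpd c ε₁) * (4 * fsD Δ tpd c (ε₁ + d) + 16 * fsN tpd (c + h) c (ε₁ + d))) =
      d * yFaceCert Δ ε₁ d c h (tpd ^ 2 - c * (ε₁ + d)) (ε₁ * (Δ + ε₁) + 4 * c * ε₁ - 4 * tpd ^ 2)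
        (8 * (Δ + (ε₁ + d)) * (tpd ^ 2 - c * (ε₁ + d)) + 16 * (2 * c + h) * (2 * tpd ^ 2 + h * (ε₁ + d)) - (ε₁ + d) * (Δ + (ε₁ + d)) ^ 2) := by
  unfold cA fsD fsN yFaceCert yFaceCertP1 yFaceCertP2 yFaceCertP3
  ring

/-! ## §2 The face ordinate is non-decreasing in the energy -/

/-- **`yFace` IS NON-DECREASING IN THE FERMI ENERGY ON THE FACE WINDOW** (`Δ ≥ 0`, `0 ≤ t_pp′ ≤ t_pp`, `0 < ε₁ ≤ ε₂`, `t_pp′ε₂ < t_pd²`, `faceG(ε₁) ≥ 0`, `cA(ε₂) ≤ (8fsD + 16fsN)(ε₂)`):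
`yFace(ε₁) ≤ yFace(ε₂)`. [folklore] -/
theorem yFace_mono {Δ tpd tpp c ε₁ ε₂ : ℝ} (hΔ : 0 ≤ Δ) (hc : 0 ≤ c) (hct : c ≤ tpp) (h1 : 0 < ε₁) (h12 : ε₁ ≤ ε₂) (hm : c * ε₂ < tpd ^ 2)
    (hlo : 0 ≤ faceG Δ tpd c ε₁) (hhi : cA Δ ε₂ ≤ 8 * fsD Δ tpd c ε₂ + 16 * fsN tpd tpp c ε₂) :
    yFace Δ tpd tpp c ε₁ ≤ yFace Δ tpd tpp c ε₂ := by
  have h2 : 0 < ε₂ := lt_of_lt_of_le h1 h12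
  have hm1 : c * ε₁ < tpd ^ 2 := lt_of_le_of_lt (mul_le_mul_of_nonneg_left h12 hc) hm
  have hD1 : 0 < fsD Δ tpd c ε₁ := fsD_pos (by linarith) hm1
  have hD2 : 0 < fsD Δ tpd c ε₂ := fsD_pos (by linarith) hm
  have hF1 : 0 < 4 * fsD Δ tpd c ε₁ + 16 * fsN tpd tpp c ε₁ := by have := fsN_nonneg (tpd := tpd) hc hct h1.le; positivity
  have hF2 : 0 < 4 * fsD Δ tpd c ε₂ + 16 * fsN tpd tpp c ε₂ := by have := fsN_nonneg (tpd := tpd) hc hct h2.le; positivity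
  unfold yFace
  rw [div_le_div_iff₀ hF1 hF2, ← sub_nonneg]
  obtain ⟨d, rfl⟩ : ∃ d, ε₂ = ε₁ + d := ⟨ε₂ - ε₁, by ring⟩
  obtain ⟨h, rfl⟩ : ∃ h, tpp = c + h := ⟨tpp - c, by ring⟩
  have hd : 0 ≤ d := by linarith
  have hh : 0 ≤ h := by linarith
  have hG₂ : 0 ≤ 8 * (Δ + (ε₁ + d)) * (tpd ^ 2 - c * (ε₁ + d)) + 16 * (2 * c + h) * (2 * tpd ^ 2 + h * (ε₁ + d)) - (ε₁ + d) * (Δ + (ε₁ + d)) ^ 2 := by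
    have e := faceHi_eq Δ tpd (c + h) c (ε₁ + d)
    have e2 : 8 * (Δ + (ε₁ + d)) * (tpd ^ 2 - c * (ε₁ + d)) + 16 * (c + (c + h - c) + c) * (2 * tpd ^ 2 + (c + h - c) * (ε₁ + d)) - (ε₁ + d) * (Δ + (ε₁ + d)) ^ 2 =
        8 * (Δ + (ε₁ + d)) * (tpd ^ 2 - c * (ε₁ + d)) + 16 * (2 * c + h) * (2 * tpd ^ 2 + h * (ε₁ + d)) - (ε₁ + d) * (Δ + (ε₁ + d)) ^ 2 := by ring
    linarith
  have hG₁ : 0 ≤ ε₁ * (Δ + ε₁) + 4 * c * ε₁ - 4 * tpd ^ 2 := by unfold faceG at hlo; linarith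
  have hM : 0 ≤ tpd ^ 2 - c * (ε₁ + d) := by linarith
  have key := yFace_cross_eq Δ tpd c h ε₁ d
  have hC := yFaceCert_nonneg (Δ := Δ) (ε₁ := ε₁) (d := d) (c := c) (h := h) (m := tpd ^ 2 - c * (ε₁ + d)) (G₁ := ε₁ * (Δ + ε₁) + 4 * c * ε₁ - 4 * tpd ^ 2)
    (G₂ := 8 * (Δ + (ε₁ + d)) * (tpd ^ 2 - c * (ε₁ + d)) + 16 * (2 * c + h) * (2 * tpd ^ 2 + h * (ε₁ + d)) - (ε₁ + d) * (Δ + (ε₁ + d)) ^ 2)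
    hΔ h1.le hd hc hh hM hG₁ hG₂
  have hX : 0 ≤ (cA Δ (ε₁ + d) - 4 * fsD Δ tpd c (ε₁ + d)) * (4 * fsD Δ tpd c ε₁ + 16 * fsN tpd (c + h) c ε₁)
      - (cA Δ ε₁ - 4 * fsD Δ tpd c ε₁) * (4 * fsD Δ tpd c (ε₁ + d) + 16 * fsN tpd (c + h) c (ε₁ + d)) := by
    have : 0 ≤ (2 : ℝ) * ((cA Δ (ε₁ + d) - 4 * fsD Δ tpd c (ε₁ + d)) * (4 * fsD Δ tpd c ε₁ + 16 * fsN tpd (c + h) c ε₁)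
      - (cA Δ ε₁ - 4 * fsD Δ tpd c ε₁) * (4 * fsD Δ tpd c (ε₁ + d) + 16 * fsN tpd (c + h) c (ε₁ + d))) := by rw [key]; exact mul_nonneg hd hC
    linarith
  linarith

/-- Equivalently: the face value of the t′ harmonic, `1 − yFace(ε)`, is NON-INCREASING in the energy on the face window. [folklore] -/
theorem one_sub_yFace_anti {Δ tpd tpp c ε₁ ε₂ : ℝ} (hΔ : 0 ≤ Δ) (hc : 0 ≤ c) (hct : c ≤ tpp) (h1 : 0 < ε₁) (h12 : ε₁ ≤ ε₂) (hm : c * ε₂ < tpd ^ 2)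
    (hlo : 0 ≤ faceG Δ tpd c ε₁) (hhi : cA Δ ε₂ ≤ 8 * fsD Δ tpd c ε₂ + 16 * fsN tpd tpp c ε₂) :
    1 - yFace Δ tpd tpp c ε₂ ≤ 1 - yFace Δ tpd tpp c ε₁ := by
  linarith [yFace_mono hΔ hc hct h1 h12 hm hlo hhi]

end Summit.Ventures.CertifiedManyBodySolver.Downfold.Emery
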